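import Summits.KontsevichZagierPeriods.Zeta5Search.LaiSweepShard

/-!
# `κ₃` sweep certificate — shard file 084 of 127 (shards 588–594 of 889)

HONEST FRAMING. Systematic search; no irrationality claim unless certified. This file only checks,
by `decide +kernel`, shards 588–594 of the order-cell sweep of the `κ₃` point `(74, 2180, 444; δ74)`
(engine `LaiSweepEngine`, soundness `LaiSweepJump/Free/Eval/Shard/Kappa3`; a shard is `⟨regime, n,
p, q, p', q', Lo, Up⟩`: `n` cells from `p/q` to `p'/q'` with integer rate sums in `[Lo, Up]`, `K =
128`, `D = 2^40`). It draws NO conclusion: only the capstone `LaiKappa3SweepCert`, which needs all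
127 shard files, does. Kernel cost of this file ≈ 560 cells × 0.3 s.
-/

namespace Summit.KontsevichZagierPeriods.Zeta5Search.Sweep

set_option maxHeartbeats 100000000 in
/-- Shard 588: 80 cells of regime B from `166/267` to `271/435`.
[cite: Lai2024BallRivoal, §4 Lemma 4.3] -/
theorem shard588 :
    Shard.check 128 (2^40)
      ⟨true, 80, 166, 267, 271, 435, 13044916134370, 17492222780051⟩ = true := by
  decide +kernel

set_option maxHeartbeats 100000000 in
/-- Shard 589: 80 cells of regime B from `271/435` to `98/157`.
[cite: Lai2024BallRivoal, §4 Lemma 4.3] -/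
theorem shard589 :
    Shard.check 128 (2^40)
      ⟨true, 80, 271, 435, 98, 157, 12509151809997, 16790767142568⟩ = true := by
  decide +kernel

set_option maxHeartbeats 100000000 in
/-- Shard 590: 80 cells of regime B from `98/157` to `269/430`.
[cite: Lai2024BallRivoal, §4 Lemma 4.3] -/
theorem shard590 :
    Shard.check 128 (2^40)
      ⟨true, 80, 98, 157, 269, 430, 14144272580593, 19006556525377⟩ = true := by
  decide +kernel

set_option maxHeartbeats 100000000 in
/-- Shard 591: 80 cells of regime B from `269/430` to `3011/4804`.
[cite: Lai2024BallRivoal, §4 Lemma 4.3] -/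
theorem shard591 :
    Shard.check 128 (2^40)
      ⟨true, 80, 269, 430, 3011, 4804, 12184976508486, 16390113946306⟩ = true := by
  decide +kernel

set_option maxHeartbeats 100000000 in
/-- Shard 592: 80 cells of regime B from `3011/4804` to `130/207`.
[cite: Lai2024BallRivoal, §4 Lemma 4.3] -/
theorem shard592 :
    Shard.check 128 (2^40)
      ⟨true, 80, 3011, 4804, 130, 207, 12817229870054, 17257836741840⟩ = true := by
  decide +kernel

set_option maxHeartbeats 100000000 in
/-- Shard 593: 80 cells of regime B from `130/207` to `3023/4804`.
[cite: Lai2024BallRivoal, §4 Lemma 4.3] -/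
theorem shard593 :
    Shard.check 128 (2^40)
      ⟨true, 80, 130, 207, 3023, 4804, 12778841880807, 17223723237995⟩ = true := by
  decide +kernel

set_option maxHeartbeats 100000000 in
/-- Shard 594: 80 cells of regime B from `3023/4804` to `157/249`.
[cite: Lai2024BallRivoal, §4 Lemma 4.3] -/
theorem shard594 :
    Shard.check 128 (2^40)
      ⟨true, 80, 3023, 4804, 157, 249, 12835615103185, 17318024361754⟩ = true := by
  decide +kernel

/-- The checked shards of this file, in order. [folklore] -/
def shards084 : List (CheckedShard 128 (2^40)) :=
  [⟨_, shard588⟩, ⟨_, shard589⟩, ⟨_, shard590⟩, ⟨_, shard591⟩, ⟨_, shard592⟩,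
    ⟨_, shard593⟩, ⟨_, shard594⟩]

end Summit.KontsevichZagierPeriods.Zeta5Search.Sweep
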